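import Literature.MathematicalPhysics.KineticTheory.HardSphereCampbellHitPieceCylinder
import Literature.MathematicalPhysics.KineticTheory.HardSphereCampbellHitPieceRelabel
import HarnessLib

/-!
# The Campbell engine for every pair and the sharp one-window bounds

Inputs of the discharge of the stationary collision-rate (Campbell / special-flow) identity
`HardSphereCampbellFormula` (Cercignani–Illner–Pulvirenti 1994, App. 4.A "`dx = ε^{d-1}|v·n| dσ dt`").

* `lintegral_hitPiece_eq_cylinder` — the ENGINE for an arbitrary ordered pair `a ≠ b` of `N` spheres
  on `T^d`: the Lebesgue integral of a mark of the post-collisional configuration over a GST hit piece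
  (intersected with an energy shell) in the pre-collision cylinder coordinates `(z, ω, τ)`,
  `u = S_{-τ}(collide_{ab}(z^{ab}_ω))`, `τ ∈ (0, δ]`, weight `ε^{d-1} ⟪ω, v_a − v_b⟫`; obtained from the
  special pair (`lintegral_hitPiece_eq_cylinder_last`) by relabelling the particles
  (`lintegral_hitPiece_comp_perm`, `lintegral_hitPieceCylinderIoc_comp_perm`); both sides vanish in
  dimension `0`.
* kinematics of the backward flight `y = S_{-τ} collide_{ab}(z^{ab}_ω)`, `0 < τ ≤ δ`, `2Vδ ≤ r`:
  if `y` lies in the hit piece and on the shell then the contact configuration `z^{ab}_ω` lies in the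
  hard-sphere domain and on the shell (`campbell_contact_mem_of_back_mem_hitPiece`); conversely, if
  `z^{ab}_ω` is on the shell, outgoing, with all other pairs farther than `ε + 2r`, then `y` lies in the
  hit piece and on the shell (`campbell_back_mem_hitPiece_of_contact`).
* the SHARP ONE-WINDOW BOUNDS: `vol(hit piece ∩ shell) ≤ δ · Flux_{ab}(1_{shell})`
  (`campbell_volume_hitPiece_shell_le`) and
  `∫_{hit piece ∩ shell} H(w⁺) ≥ δ · ∫∫ ε^{d-1}⟪ω, v_a − v_b⟫ 1_{shell, others > ε+2r}(z^{ab}_ω) H(z^{ab}_ω)`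
  (`campbell_lintegral_hitPiece_shell_ge`).

## References

* C. Cercignani, R. Illner, M. Pulvirenti, *The Mathematical Theory of Dilute Gases*, Springer
  (1994), §4.2, App. 4.A pp. 107–111.
* I. Gallagher, L. Saint-Raymond, B. Texier, *From Newton to Boltzmann*, EMS (2013), proof of
  Prop. 4.1.1 p. 19.
-/

open MeasureTheory Set Function Filter Metric
open scoped ENNReal NNReal RealInnerProductSpace

namespace Literature.MathematicalPhysics.KineticTheory

open Literature.Analysis.FluidPDE

noncomputable section

variable {d : Type*} [Fintype d] {N : ℕ} {ε : ℝ}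

/-! ### Dimension zero

In dimension `0` every vector of `ℝ^d` has norm `0`: this is Mathlib's `norm_of_subsingleton`. -/

/-- In dimension `0` the hit pieces are empty (`ε > 0`): they ask for a pair at distance `> ε`.
[folklore] -/
theorem campbell_hitPiece_eq_empty_of_isEmpty [IsEmpty d] (hε : 0 < ε) (r δ : ℝ) (a b : Fin N) :
    Alexander.hitPiece N ε r δ a b = (∅ : Set (Config N d (UnitAddTorus d))) := by
  ext z
  simp only [mem_empty_iff_false, iff_false]
  intro hz
  have h : ε < ‖(Torus.geometry d).sepVec (z a).1 (z b).1‖ := hz.2.2.1.1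
  rw [norm_of_subsingleton] at h
  exact lt_irrefl _ (h.trans hε)

/-- In dimension `0` the unit sphere is empty, so every integral against the surface measure
vanishes. [folklore] -/
theorem campbell_lintegral_sphere_eq_zero_of_isEmpty [IsEmpty d]
    (f : Metric.sphere (0 : EuclideanSpace ℝ d) 1 → ℝ≥0∞) :
    ∫⁻ ω, f ω ∂(volume : Measure (EuclideanSpace ℝ d)).toSphere = 0 := by
  haveI : IsEmpty (Metric.sphere (0 : EuclideanSpace ℝ d) 1) := by
    refine ⟨fun ω => ?_⟩
    have h := norm_eq_of_mem_sphere ω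
    rw [norm_of_subsingleton] at h
    exact zero_ne_one h
  rw [Measure.eq_zero_of_isEmpty ((volume : Measure (EuclideanSpace ℝ d)).toSphere), lintegral_zero_measure]

/-! ### The engine for every pair -/

/-- A permutation of `Fin (s + 2)` sending a given pair `a ≠ b` to (last, first). [folklore] -/
theorem campbell_exists_perm_pair {s : ℕ} {a b : Fin (s + 1 + 1)} (hab : a ≠ b) :
    ∃ σ : Equiv.Perm (Fin (s + 1 + 1)), σ a = Fin.natAdd (s + 1) 0 ∧ σ b = Fin.castAdd 1 0 := by
  set L : Fin (s + 1 + 1) := Fin.natAdd (s + 1) 0 with hL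
  set C : Fin (s + 1 + 1) := Fin.castAdd 1 0 with hC
  have hLC : L ≠ C := by
    intro h
    have := congrArg Fin.val h
    simp [hL, hC] at this
  set b' := Equiv.swap a L b with hb'
  have hb'L : b' ≠ L := by
    intro h
    rw [hb', Equiv.swap_apply_eq_iff, Equiv.swap_apply_right] at h
    exact hab h.symm
  refine ⟨(Equiv.swap b' C).trans (Equiv.refl _) |>.symm.symm |> fun _ => (Equiv.swap a L).trans (Equiv.swap b' C), ?_, ?_⟩
  · show Equiv.swap b' C (Equiv.swap a L a) = L
    rw [Equiv.swap_apply_left, Equiv.swap_apply_of_ne_of_ne hb'L.symm hLC]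
  · show Equiv.swap b' C (Equiv.swap a L b) = C
    rw [← hb', Equiv.swap_apply_left]

/-- **The Campbell engine for every ordered pair.** For `N` spheres of diameter `ε > 0` on `T^d`,
chart room `ε + 2r < 1/2`, displacement room `2Vδ ≤ r` (`V, δ ≥ 0`), a pair `a ≠ b` and a measurable
mark `H ≥ 0`: the Lebesgue integral over the hit piece `hit(a,b) ∩ {E ≤ V²/2}` of `H` read on the
post-collisional configuration `collide_{ab}(S_{τ₀(u)} u)` equals the cylinder-coordinate integral
`∫ dz ∫ dω ∫_{τ ∈ (0,δ]} ε^{d-1} ⟪ω, v_a − v_b⟫ 1_{hit(a,b) ∩ shell}(S_{-τ} collide_{ab} z^{ab}_ω) H(z^{ab}_ω)`,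
`z^{ab}_ω = contactInsert ε a b ω z` (CIP 1994 App. 4.A: in the special flow representation the
Lebesgue measure becomes `dσ dt`, `dσ = ε^{d-1}|n·(ξ_a − ξ_b)| dγ ∏ dx ∏ dξ`). [cite: CIP1994, App. 4.A pp. 107–111] -/
theorem lintegral_hitPiece_eq_cylinder {r δ V : ℝ} (hε : 0 < ε) (hch : ε + 2 * r < 2⁻¹)
    (hr : 2 * V * δ ≤ r) (hV : 0 ≤ V) (hδ : 0 ≤ δ) {a b : Fin N} (hab : a ≠ b)
    {H : Config N d (UnitAddTorus d) → ℝ≥0∞} (hH : Measurable H) :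
    ∫⁻ u : Config N d (UnitAddTorus d),
        (Alexander.hitPiece N ε r δ a b ∩ {u | configEnergy u ≤ V ^ 2 / 2}).indicator
          (fun u => H (collidePair (Torus.geometry d) a b
            (freeFlight (Torus.geometry d)
              (pairHitTime ε ((Torus.geometry d).sepVec (u a).1 (u b).1) ((u a).2 - (u b).2)) u))) u =
      ∫⁻ z : Config N d (UnitAddTorus d), ∫⁻ ω : Metric.sphere (0 : EuclideanSpace ℝ d) 1,
        ∫⁻ τ in Ioc (0 : ℝ) δ,
          ENNReal.ofReal (ε ^ (Fintype.card d - 1) * ⟪((ω : EuclideanSpace ℝ d)), (z a).2 - (z b).2⟫) *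
            (Alexander.hitPiece N ε r δ a b ∩ {u | configEnergy u ≤ V ^ 2 / 2}).indicator (fun _ => (1 : ℝ≥0∞))
              (freeFlight (Torus.geometry d) (-τ)
                (collidePair (Torus.geometry d) a b (contactInsert ε a b (ω : EuclideanSpace ℝ d) z))) *
            H (contactInsert ε a b (ω : EuclideanSpace ℝ d) z)
        ∂volume ∂(volume : Measure (EuclideanSpace ℝ d)).toSphere := by
  rcases isEmpty_or_nonempty d with hd | hd
  · -- dimension 0: both sides vanish
    rw [campbell_hitPiece_eq_empty_of_isEmpty hε r δ a b, empty_inter]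
    simp only [indicator_empty, lintegral_const, zero_mul]
    rw [lintegral_congr fun z => campbell_lintegral_sphere_eq_zero_of_isEmpty _, lintegral_zero]
  · -- positive dimension: relabel to the special pair of `lintegral_hitPiece_eq_cylinder_last`
    obtain ⟨s, rfl⟩ : ∃ s, N = s + 1 + 1 := by
      have h2 : 2 ≤ N := by
        rcases Nat.lt_or_ge N 2 with h | h
        · exfalso
          have : Subsingleton (Fin N) := by
            rcases Nat.lt_succ_iff.1 h |>.lt_or_eq with h' | h'
            · have : N = 0 := by omega
              subst this; infer_instance
            · subst h'; infer_instance
          exact hab (Subsingleton.elim a b)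
        · exact h
      exact ⟨N - 2, by omega⟩
    obtain ⟨σ, hσa, hσb⟩ := campbell_exists_perm_pair hab
    have hHσ : Measurable fun w : Config (s + 1 + 1) d (UnitAddTorus d) => H (w ∘ σ) :=
      hH.comp (measurable_pi_lambda _ fun k => measurable_pi_apply (σ k))
    have h1 := lintegral_hitPiece_comp_perm (d := d) σ (r := r) (δ := δ) (V := V) ε hab hH
    have h2 := lintegral_hitPieceCylinderIoc_comp_perm (d := d) σ (r := r) (δ := δ) (V := V) ε hab hH
    have h3 := lintegral_hitPiece_eq_cylinder_last (d := d) (ε := ε) (0 : Fin (s + 1)) hε hch hr hV hδ hHσ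
    simp only [hσa, hσb] at h1 h2
    rw [h1, h2]
    exact h3

/-! ### Kinematics of the backward flight -/

/-- **From the hit piece to the contact configuration.** Let `0 ≤ ε < 1/2`, `a ≠ b`, `2Vδ ≤ r`,
`V ≥ 0`, `ω` a unit vector and `0 < τ ≤ δ`. If the backward flight
`y = S_{-τ}(collide_{ab}(z^{ab}_ω))` of the incoming contact configuration lies in the hit piece
`hit(a,b)` (room `r`, window `δ`) and on the shell `E ≤ V²/2`, then the contact configuration
`z^{ab}_ω` lies in the hard-sphere domain and on the shell: the pair `(a,b)` is at distance exactly
`ε`, and every other pair, farther than `ε + r` in `y`, stays farther than `ε` during the flight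
(displacements `≤ 2Vτ ≤ r`). [folklore] -/
theorem campbell_contact_mem_of_back_mem_hitPiece {r δ V : ℝ} (hε0 : 0 ≤ ε) (hε : ε < 1 / 2)
    {a b : Fin N} (hab : a ≠ b) (hr : 2 * V * δ ≤ r) (hV : 0 ≤ V)
    (ω : Metric.sphere (0 : EuclideanSpace ℝ d) 1) (z : Config N d (UnitAddTorus d)) {τ : ℝ}
    (hτ : τ ∈ Ioc (0 : ℝ) δ)
    (hy : freeFlight (Torus.geometry d) (-τ)
        (collidePair (Torus.geometry d) a b (contactInsert ε a b (ω : EuclideanSpace ℝ d) z)) ∈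
      Alexander.hitPiece N ε r δ a b ∩ {u | configEnergy u ≤ V ^ 2 / 2}) :
    contactInsert ε a b (ω : EuclideanSpace ℝ d) z ∈ hardSphereDomain (Torus.geometry d) N ε ∧
      configEnergy (contactInsert ε a b (ω : EuclideanSpace ℝ d) z) ≤ V ^ 2 / 2 := by
  set cI := contactInsert ε a b (ω : EuclideanSpace ℝ d) z with hcI
  set wIn := collidePair (Torus.geometry d) a b cI with hwIn
  set y := freeFlight (Torus.geometry d) (-τ) wIn with hydef
  obtain ⟨hyhit, hyE⟩ := hy
  have hEw : configEnergy wIn = configEnergy cI := configEnergy_collidePair hab cI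
  have hEy : configEnergy y = configEnergy cI := by
    rw [hydef, configEnergy_freeFlight, hEw]
  have hEcI : configEnergy cI ≤ V ^ 2 / 2 := by rw [← hEy]; exact hyE
  refine ⟨?_, hEcI⟩
  -- speeds of `y` are at most `V`
  have hvy : ∀ i, ‖(y i).2‖ ≤ V := fun i => norm_vel_le_of_configEnergy_le hV hyE i
  -- flying forward for `τ` brings `y` back to `wIn`, whose positions are those of `cI`
  have hflight : freeFlight (Torus.geometry d) τ y = wIn := by
    rw [hydef, ← freeFlight_add, add_neg_cancel, freeFlight_zero]
  have hpos : ∀ k, (wIn k).1 = (cI k).1 := fun k => collidePair_apply_fst cI k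
  intro k l hkl
  by_cases hpair : ({k, l} : Finset (Fin N)) = {a, b}
  · -- the colliding pair itself is at distance exactly `ε`
    have hnorm : ‖(Torus.geometry d).sepVec (cI a).1 (cI b).1‖ = ε :=
      norm_sepVec_contactInsert hε0 hε hab (norm_eq_of_mem_sphere ω) z
    rcases Alexander.finsetPair_eq_iff.1 hpair with ⟨rfl, rfl⟩ | ⟨rfl, rfl⟩
    · exact hnorm.ge
    · rw [Alexander.norm_sepVec_comm]
      exact hnorm.ge
  · -- the other pairs stay farther than `ε` during the flight
    have hfar : ε + r < ‖(Torus.geometry d).sepVec (y k).1 (y l).1‖ := hyhit.1 k l hkl hpair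
    have hτabs : |τ| ≤ δ := by rw [abs_of_pos hτ.1]; exact hτ.2
    have h := Alexander.lt_norm_sepVec_freeFlight_of_far hvy hr hfar hτabs
    rw [hflight, hpos k, hpos l] at h
    exact h.le

/-- **From the contact configuration to the hit piece.** Let `ε > 0`, `ε + 2r < 1/2`, `2Vδ ≤ r`,
`V ≥ 0`, `a ≠ b`, `ω` a unit vector and `0 < τ ≤ δ`. If the contact configuration `z^{ab}_ω` is on
the shell `E ≤ V²/2`, OUTGOING (`⟪ω, v_a − v_b⟫ > 0`) and all its other pairs are farther than
`ε + 2r`, then the backward flight `y = S_{-τ}(collide_{ab}(z^{ab}_ω))` lies in the hit piece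
`hit(a,b)` (room `r`, window `δ`) and on the shell: in the chart its relative datum is
`(εω − τ g⁻, g⁻)` with `⟪εω, g⁻⟫ = −ε⟪ω, v_a − v_b⟫ < 0` (the incoming velocities), which is
approaching, non-grazing (discriminant `ε²⟪ω, g⁻⟫²`), at distance `∈ (ε, ε + r]`, and hits at time
exactly `τ ≤ δ`; the other pairs move by at most `2Vτ ≤ r`. [folklore] -/
theorem campbell_back_mem_hitPiece_of_contact {r δ V : ℝ} (hε : 0 < ε) (hch : ε + 2 * r < 2⁻¹)
    (hr : 2 * V * δ ≤ r) (hV : 0 ≤ V) {a b : Fin N} (hab : a ≠ b)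
    (ω : Metric.sphere (0 : EuclideanSpace ℝ d) 1) (z : Config N d (UnitAddTorus d)) {τ : ℝ}
    (hτ : τ ∈ Ioc (0 : ℝ) δ)
    (hE : configEnergy (contactInsert ε a b (ω : EuclideanSpace ℝ d) z) ≤ V ^ 2 / 2)
    (hfar : Alexander.OthersFar ε (2 * r) (contactInsert ε a b (ω : EuclideanSpace ℝ d) z) a b)
    (hflux : 0 < ⟪((ω : EuclideanSpace ℝ d)), (z a).2 - (z b).2⟫) :
    freeFlight (Torus.geometry d) (-τ)
        (collidePair (Torus.geometry d) a b (contactInsert ε a b (ω : EuclideanSpace ℝ d) z)) ∈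
      Alexander.hitPiece N ε r δ a b ∩ {u | configEnergy u ≤ V ^ 2 / 2} := by
  set cI := contactInsert ε a b (ω : EuclideanSpace ℝ d) z with hcI
  set wIn := collidePair (Torus.geometry d) a b cI with hwIn
  set y := freeFlight (Torus.geometry d) (-τ) wIn with hydef
  have hδ : 0 ≤ δ := hτ.1.le.trans hτ.2
  have hr0 : 0 ≤ r := le_trans (by positivity) hr
  have hε2 : ε < 1 / 2 := by linarith
  have hω : ‖(ω : EuclideanSpace ℝ d)‖ = 1 := norm_eq_of_mem_sphere ω
  -- energies
  have hEw : configEnergy wIn = configEnergy cI := configEnergy_collidePair hab cI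
  have hEy : configEnergy y = configEnergy cI := by rw [hydef, configEnergy_freeFlight, hEw]
  have hvw : ∀ i, ‖(wIn i).2‖ ≤ V := fun i => norm_vel_le_of_configEnergy_le hV (hEw.le.trans hE) i
  -- the contact data
  have hsep : (Torus.geometry d).sepVec (cI a).1 (cI b).1 = ε • (ω : EuclideanSpace ℝ d) :=
    sepVec_contactInsert hε.le hε2 hab hω.le z
  set n : EuclideanSpace ℝ d := ε • (ω : EuclideanSpace ℝ d) with hndef
  have hn : ‖n‖ = ε := by rw [hndef, norm_smul, Real.norm_of_nonneg hε.le, hω, mul_one]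
  have hn0 : n ≠ 0 := by
    intro h; rw [h, norm_zero] at hn; exact hε.ne' hn.symm
  have hvela : (cI a).2 = (z a).2 := contactInsert_vel ε a b _ z a
  have hvelb : (cI b).2 = (z b).2 := contactInsert_vel ε a b _ z b
  -- positions and velocities of the incoming configuration
  have hpos : ∀ k, (wIn k).1 = (cI k).1 := fun k => collidePair_apply_fst cI k
  set gIn : EuclideanSpace ℝ d := (wIn a).2 - (wIn b).2 with hgIn
  have hinner : ⟪n, gIn⟫ = -(ε * ⟪((ω : EuclideanSpace ℝ d)), (z a).2 - (z b).2⟫) := by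
    have h := inner_reflectVel_fst_sub_snd n hn0 ((cI a).2, (cI b).2)
    rw [hgIn, hwIn, collidePair_apply_left hab, collidePair_apply_right, hsep]
    dsimp only
    rw [h, hvela, hvelb, hndef, real_inner_smul_left]
  clear_value n
  have hin : ⟪n, gIn⟫ < 0 := by rw [hinner]; exact neg_neg_of_pos (mul_pos hε hflux)
  have hgIn_le : ‖gIn‖ ≤ 2 * V := Alexander.norm_vel_sub_le hvw a b
  -- the separation of the pair in the incoming configuration, and along the backward flight
  have hsepw : (Torus.geometry d).sepVec (wIn a).1 (wIn b).1 = n := by rw [hpos a, hpos b, hsep]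
  have hτV : τ * ‖gIn‖ ≤ r := by
    calc τ * ‖gIn‖ ≤ δ * (2 * V) :=
          mul_le_mul hτ.2 hgIn_le (norm_nonneg _) hδ
      _ = 2 * V * δ := by ring
      _ ≤ r := hr
  have hchart : ‖(Torus.geometry d).sepVec (wIn a).1 (wIn b).1‖ + |(-τ)| * ‖(wIn a).2 - (wIn b).2‖ < 1 / 2 := by
    rw [hsepw, hn, abs_neg, abs_of_pos hτ.1, ← hgIn]
    have : (2⁻¹ : ℝ) = 1 / 2 := by norm_num
    linarith
  have hsepy : (Torus.geometry d).sepVec (y a).1 (y b).1 = n - τ • gIn := by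
    rw [hydef, Alexander.sepVec_freeFlight_eq hchart, hsepw, ← hgIn, neg_smul, sub_eq_add_neg]
  have hvely : (y a).2 - (y b).2 = gIn := by simp [hydef, hgIn]
  -- the relative datum `(n - τ gIn, gIn)`
  have hq_sq : ‖n - τ • gIn‖ ^ 2 = ε ^ 2 - 2 * τ * ⟪n, gIn⟫ + τ ^ 2 * ‖gIn‖ ^ 2 := by
    rw [norm_sub_sq_real, real_inner_smul_right, norm_smul, mul_pow, Real.norm_eq_abs, sq_abs, hn]
    ring
  have hq_gt : ε < ‖n - τ • gIn‖ := by
    refine lt_of_pow_lt_pow_left₀ 2 (norm_nonneg _) ?_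
    rw [hq_sq]
    nlinarith [hτ.1, hin, sq_nonneg ‖gIn‖, sq_nonneg τ]
  have hq_le : ‖n - τ • gIn‖ ≤ ε + r := by
    calc ‖n - τ • gIn‖ ≤ ‖n‖ + ‖τ • gIn‖ := norm_sub_le _ _
      _ = ε + τ * ‖gIn‖ := by rw [hn, norm_smul, Real.norm_of_nonneg hτ.1.le]
      _ ≤ ε + r := by linarith
  have hqg : ⟪n - τ • gIn, gIn⟫ < 0 := by
    rw [inner_sub_left, real_inner_smul_left, real_inner_self_eq_norm_sq]
    nlinarith [hτ.1, hin, sq_nonneg ‖gIn‖]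
  have hdisc : 0 < pairDisc ε (n - τ • gIn) gIn := by
    unfold pairDisc
    rw [inner_sub_left, real_inner_smul_left, real_inner_self_eq_norm_sq, hq_sq]
    have : (⟪n, gIn⟫ - τ * ‖gIn‖ ^ 2) ^ 2 - ‖gIn‖ ^ 2 * (ε ^ 2 - 2 * τ * ⟪n, gIn⟫ + τ ^ 2 * ‖gIn‖ ^ 2 - ε ^ 2) =
        ⟪n, gIn⟫ ^ 2 := by ring
    rw [this]
    exact sq_pos_of_neg hin
  have hhit : pairHitTime ε (n - τ • gIn) gIn = τ := campbell_pairHitTime_contact_sub_smul hε.le hn hin τ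
  refine ⟨⟨?_, ?_, ?_, ?_⟩, ?_⟩
  · -- the other pairs are far in `y`
    intro k l hkl hpair
    have hfar' : ε + r + r < ‖(Torus.geometry d).sepVec (wIn k).1 (wIn l).1‖ := by
      rw [hpos k, hpos l]
      have := hfar k l hkl hpair
      linarith
    have hτabs : |(-τ)| ≤ δ := by rw [abs_neg, abs_of_pos hτ.1]; exact hτ.2
    exact Alexander.lt_norm_sepVec_freeFlight_of_far hvw hr hfar' hτabs
  · rw [hsepy]; exact hq_le
  · rw [hsepy, hvely]; exact ⟨hq_gt, hqg, hdisc⟩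
  · rw [hsepy, hvely, hhit]; exact hτ.2
  · show configEnergy y ≤ V ^ 2 / 2
    rw [hEy]; exact hE

end

end Literature.MathematicalPhysics.KineticTheory
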